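import Summits.BirchSwinnertonDyer.BirchSwinnertonDyer.Theorems.KatoDescentPotSupersingularFineSelmerControl
import Summits.BirchSwinnertonDyer.BirchSwinnertonDyer.Theorems.KatoDescentPotSupersingularWildFineSelmerSupersingularUnitAnchor
import HarnessLib

/-!
# The FINE UNIT-ANCHOR road to the Conj-A crux `WildFineSelmerCoatesSujatha`
# (item stmt-BirchSwinnertonDyer-19386; route `KatoDescentPotSupersingular`, rung K9, cell `bsd-potss`):
# an `E[3]`-congruent anchor of ANY reduction type at `3` with `rank 0`, `Ш[3] = 0` and no local
# `3`-torsion at its bad places and at `3` ⟹ `Sel₀(E′/ℚ_∞) = 0` ⟹ (A) at `(E′,3)` ⟹ (A) at the row ⟹ Upper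
# (a `--supports … --as helper` file; seat `bsd-potss-k9-c4` g6; ROUTE-FREE; nothing booked, BSD is not
# proved by any of this)

WHY. Every anchor road to the crux so far (ordinary unit anchors p457401, CM anchors p462275/p467612,
supersingular unit anchors p468234) needs the congruent anchor `E′` to have GOOD reduction at `3`, because
(A) at `(E′,3)` is read off the classical / signed Iwasawa theory of `E′` at a good prime. The census of
seat `conjA-anchor` g0 (FINDING-19386-19413-conjA-anchor-g0.md) leaves 149 of the 228 `3Nn` rows of the crux
with congruent partners that are all ADDITIVE at `3`, and further ♯ rows without any good partner. The fine
control theorem of the sibling `…FineSelmerControl.lean` (Greenberg's Prop. 3.8 for the FINE Selmer group,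
reduction-type-free: `#Sel_{p^∞}(E′/ℚ) = 1` and `E′(ℚ_v)[p] = 0` at the bad places and at `p` ⟹
`Sel₀(E′/ℚ_∞) = 0`) removes the reduction hypothesis: (A) at `(E′,3)` holds OUTRIGHT (the fine Selmer
group over `ℚ_∞` vanishes) for any anchor with

  `rank E′(ℚ) = 0`, `#Ш(E′/ℚ)[3^∞] = 1`, and no non-zero `D_v`-fixed `3`-torsion in `E′[3^∞]`
  (`= E′(ℚ_v)[3] = 0`) for `v` in a finite set `S ⊇ {3} ∪ {bad places of E′}`,

whatever the reduction of `E′` at `3` (the condition at `v = 3` is a property of the ROW, `E′[3] ≅ E[3]`).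
No Tamagawa number, no `a_p`, no `p`-adic `L`-function, no main conjecture enters; the only named facts
are those of the row side (Lim–Sujatha `hLS` p445851, Kato's fine reading `hKatoA` p420034, GZK,
modularity).

* §1 `conjA_of_fineUnitData` (any number field / `ℤ_p`-extension) and `conjA_rat_of_fineUnitData`,
  `…_analyticRankZero_…` (`r_an(E′) = 0`, `p ∤ #Ш(E′)`).
* §2 the ROW ROADS **`missingUpperBoundAt_wild_of_fineUnitAnchor`** (+ `_analytic`, + `_smallConductor`:
  `N_{E′} < 5000`, `Ш_an(E′) = m`, `3 ∤ m`, via bsd.S31 / g4's `natCard_sha_eq_of_conductor_lt_of_shaAn_eq`).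
* §3 class form `wildFineSelmerCoatesSujatha_of_fineUnitAnchorCertificates` (the `hcert` currency).

HONEST FRAMING: conditional-results on the displayed named facts of the ROW side only (all already typed in
the tree; no new fact); the anchor side is an unconditional kernel theorem; the per-row data (congruence,
rank, `Ш[3]`, local `3`-torsion) are hypotheses (data of record, not kernel inputs); items 19386/19197 are
NOT closed; class-wide the crux remains Coates–Sujatha (A), a named open problem. References:
[GreenbergLNM1716] Prop. 3.8 (pp. 95–96); [CoatesSujatha2005] §3; [LimSujatha2018] §3 Prop. 3.2;
[Kato2004Asterisque] Thm. 14.5 (3), Prop. 14.16 (2); [CreutzMiller2012] Thm. 1.1 (bsd.S31).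
-/

set_option autoImplicit false
-- sibling precedent (`KatoDescentPotSupersingularAssembly.lean`): the directory name repeats the summit name
set_option linter.dupNamespace false

noncomputable section

open scoped Classical

universe u

namespace Summit.BirchSwinnertonDyer.BirchSwinnertonDyer.Theorems.WildFineSelmerFineUnitAnchor

open NumberField IsDedekindDomain Field
open WeierstrassCurve Literature.NumberTheory.EllipticCurves
  Literature.NumberTheory.EllipticCurves.GreenbergSelmer
  Literature.NumberTheory.EllipticCurves.IwasawaAlgebra
  Literature.NumberTheory.EllipticCurves.Rank1Residual
  Literature.NumberTheory.EllipticCurves.Rank1Residual.Typed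
  Literature.NumberTheory.EllipticCurves.ZpExtension
  Summit.BirchSwinnertonDyer.Rank1Residual Summit.BirchSwinnertonDyer.Rank1Residual.Additive
  Summit.BirchSwinnertonDyer.Rank1Residual.O6
  Summit.BirchSwinnertonDyer.BirchSwinnertonDyer.Theorems

/-! ## §1 (A) at `(E′, p)` from the fine unit data -/

section AnyField

variable {K : Type u} [Field K] [NumberField K] (W : WeierstrassCurve K) [W.IsElliptic] {p : ℕ}
  [Fact p.Prime]

/-- **(A) at `(E, p)` over ANY `ℤ_p`-extension from the fine unit data** (number field `K`): `rank E(K) = 0`,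
`#Ш(E/K)[p^∞] = 1`, and no non-zero `p`-torsion element of `E[p^∞]` fixed by `D_v` for `v` in a finite set `S`
off which `E` is good and `v ∤ p` — then `Sel₀(K_∞, E[p^∞]) = 0`, so its Pontryagin dual is finitely
generated over `ℤ_p` (`FineSelmerControl.conjA_of_natCard_selmerGroupPInfty_eq_one`, with
`#Sel_{p^∞}(E/K) = #Ш[p^∞] = 1` in rank `0`). No reduction hypothesis at `v ∣ p`.
[cite: GreenbergLNM1716, Prop. 3.8 (pp. 95–96)] [cite: CoatesSujatha2005, §3 (Conjecture A)] -/
theorem conjA_of_fineUnitData (S : Finset (HeightOneSpectrum (𝓞 K)))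
    (hS : ∀ v ∉ S, ((p : ℕ) : 𝓞 K) ∉ v.asIdeal ∧ W.HasGoodReductionAt v)
    (hrank : W.mordellWeilRank = 0) (hsha : Nat.card (AddCommGroup.primaryComponent W.sha p) = 1)
    (hloc : ∀ v ∈ S, ∀ x : W.geomPrimaryTorsion p, p • x = 0 → (∀ d ∈ decomp v, d • x = x) → x = 0)
    (κ : ZpExtension K p) :
    ∃ (γ : absoluteGaloisGroup K) (D : W.FineSelmerDualData κ γ),
      Module.Finite ℤ_[p] (RestrictScalars ℤ_[p] (IwasawaAlgebra p) D.X) := by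
  haveI : Finite W.toAffine.Point := W.mordellWeilRank_eq_zero_iff_finite.mp hrank
  have hcardSel : Nat.card (W.selmerGroupPInfty p) = 1 := by
    rw [W.natCard_selmerGroupPInfty_eq_natCard_primaryComponent_sha p, hsha]
  exact FineSelmerControl.conjA_of_natCard_selmerGroupPInfty_eq_one W κ S hS hcardSel hloc

/-- **`Sel₀(K_∞, E[p^∞]) = 0` from the fine unit data** (the vanishing itself, for consumers that want
more than (A)). [cite: GreenbergLNM1716, Prop. 3.8 (pp. 95–96)] -/
theorem fineSelmerInfty_eq_bot_of_fineUnitData (S : Finset (HeightOneSpectrum (𝓞 K)))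
    (hS : ∀ v ∉ S, ((p : ℕ) : 𝓞 K) ∉ v.asIdeal ∧ W.HasGoodReductionAt v)
    (hrank : W.mordellWeilRank = 0) (hsha : Nat.card (AddCommGroup.primaryComponent W.sha p) = 1)
    (hloc : ∀ v ∈ S, ∀ x : W.geomPrimaryTorsion p, p • x = 0 → (∀ d ∈ decomp v, d • x = x) → x = 0)
    (κ : ZpExtension K p) : W.fineSelmerInfty κ = ⊥ := by
  haveI : Finite W.toAffine.Point := W.mordellWeilRank_eq_zero_iff_finite.mp hrank
  have hcardSel : Nat.card (W.selmerGroupPInfty p) = 1 := by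
    rw [W.natCard_selmerGroupPInfty_eq_natCard_primaryComponent_sha p, hsha]
  exact FineSelmerControl.fineSelmerInfty_eq_bot_of_natCard_selmerGroupPInfty_eq_one W κ S hS hcardSel hloc

end AnyField

section Rat

/-- **(A) at `(E, p)` over `ℚ` for every cyclotomic `κ` from the fine unit data**, in the exact `∃`-form of
the crux and of the Lim–Sujatha transfer (`conjA_of_modPCongruent`). (It holds for EVERY `ℤ_p`-extension;
the cyclotomic hypothesis is not used.) [cite: CoatesSujatha2005, §3 (Conjecture A)]
[cite: GreenbergLNM1716, Prop. 3.8 (pp. 95–96)] -/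
theorem conjA_rat_of_fineUnitData (W : WeierstrassCurve ℚ) [W.IsElliptic] {p : ℕ} [Fact p.Prime]
    (S : Finset (HeightOneSpectrum (𝓞 ℚ)))
    (hS : ∀ v ∉ S, ((p : ℕ) : 𝓞 ℚ) ∉ v.asIdeal ∧ W.HasGoodReductionAt v)
    (hrank : W.mordellWeilRank = 0) (hsha : Nat.card (AddCommGroup.primaryComponent W.sha p) = 1)
    (hloc : ∀ v ∈ S, ∀ x : W.geomPrimaryTorsion p, p • x = 0 → (∀ d ∈ decomp v, d • x = x) → x = 0) :
    ∀ (κ : ZpExtension ℚ p), κ.IsCyclotomic →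
      ∃ (γ : absoluteGaloisGroup ℚ) (D : W.FineSelmerDualData κ γ),
        Module.Finite ℤ_[p] (RestrictScalars ℤ_[p] (IwasawaAlgebra p) D.X) :=
  fun κ _ ↦ conjA_of_fineUnitData W S hS hrank hsha hloc κ

/-- Variant with the global data in PRINTED form: `r_an(E) = 0` (so `E(ℚ)` and `Ш(E/ℚ)` are finite by
Gross–Zagier–Kolyvagin, `hGZK`) and `p ∤ #Ш(E/ℚ)`. [cite: CoatesSujatha2005, §3 (Conjecture A)]
[cite: GreenbergLNM1716, Prop. 3.8 (pp. 95–96)] -/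
theorem conjA_rat_of_analyticRankZero_of_fineUnitData (hGZK : rank_eq_analyticRank_of_analyticRank_le_one)
    (W : WeierstrassCurve ℚ) [W.IsElliptic] {p : ℕ} [Fact p.Prime]
    (S : Finset (HeightOneSpectrum (𝓞 ℚ)))
    (hS : ∀ v ∉ S, ((p : ℕ) : 𝓞 ℚ) ∉ v.asIdeal ∧ W.HasGoodReductionAt v)
    (hr : W.analyticRank = 0) (hsha : ¬ p ∣ Nat.card W.sha)
    (hloc : ∀ v ∈ S, ∀ x : W.geomPrimaryTorsion p, p • x = 0 → (∀ d ∈ decomp v, d • x = x) → x = 0) :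
    ∀ (κ : ZpExtension ℚ p), κ.IsCyclotomic →
      ∃ (γ : absoluteGaloisGroup ℚ) (D : W.FineSelmerDualData κ γ),
        Module.Finite ℤ_[p] (RestrictScalars ℤ_[p] (IwasawaAlgebra p) D.X) := by
  obtain ⟨hmw, hfin⟩ := hGZK W (by rw [hr]; exact zero_le_one)
  haveI : Finite W.sha := hfin
  have hrank : W.mordellWeilRank = 0 := by rw [hmw, hr]
  have h1 : Nat.card (AddCommGroup.primaryComponent W.sha p) = 1 := by
    rw [card_addPrimaryComponent_eq_pow p, Nat.factorization_eq_zero_of_not_dvd hsha, pow_zero]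
  exact conjA_rat_of_fineUnitData W S hS hrank h1 hloc

end Rat

/-! ## §2 The row roads: Upper at a ♯ row from ONE congruent fine unit anchor of ANY reduction type at `3` -/

/-- **The FINE UNIT-ANCHOR road, row form.** Let `W/ℚ` be a row of the Conj-A crux of route K9 (globally
minimal, `r_an = 0`, `ClassO6 W 3`, `W[3]` irreducible) and `W′` an elliptic curve over `ℚ` with
`W′[3] ≅ W[3]` (`ModPCongruent W′ W 3`) — of ANY reduction type at `3`, in particular additive — such that
`rank W′(ℚ) = 0`, `#Ш(W′/ℚ)[3^∞] = 1`, and for every `v` in a finite set `S` of finite places (off which `W′`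
is good and `v ∤ 3`) no non-zero `3`-torsion element of `W′[3^∞]` is fixed by the decomposition group `D_v`
(`W′(ℚ_v)[3] = 0`; at `v = 3` this is a property of the ROW). Then `ord₃ #Ш(W) ≤ ord₃ #Ш_an(W)`
(`MissingUpperBoundAt W 3`): `Sel₀(W′/ℚ_∞) = 0` (fine control) ⟹ (A) at `(W′,3)` ⟹ (A) at `(W,3)`
(Lim–Sujatha, `hLS`) ⟹ Upper (Kato's fine reading `hKatoA`, GZK, modularity; p467612's
`missingUpperBoundAt_wild_of_conjA`). [cite: GreenbergLNM1716, Prop. 3.8 (pp. 95–96)]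
[cite: LimSujatha2018, §3 Prop. 3.2] [cite: Kato2004Asterisque, Thm. 14.5 (3) and Prop. 14.16 (2)]
[cite: CoatesSujatha2005, §3 (Conjecture A)] -/
theorem missingUpperBoundAt_wild_of_fineUnitAnchor
    (hLS : LimSujatha2018.prop32_fineSelmerDual_moduleFinite_iff_of_torsionIso)
    (hKatoA :
      Kato2004.rankZero_padicValNat_sha_add_padicValNat_tamagawa_le_of_additive_potGood_of_irreducible_of_fineSelmerDual_fg)
    (hGZK : rank_eq_analyticRank_of_analyticRank_le_one) (hmod : hasEntireLFunction_rat)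
    (W : WeierstrassCurve ℚ) [W.IsElliptic] [W.IsGloballyMinimal] [Fact (3 : ℕ).Prime]
    (hr : W.analyticRank = 0) (hO : ClassO6 W 3) (hirr : W.HasIrreducibleModPGaloisRep 3)
    (W' : WeierstrassCurve ℚ) [W'.IsElliptic] (hcong : ModPCongruent W' W 3)
    (S : Finset (HeightOneSpectrum (𝓞 ℚ)))
    (hS : ∀ v ∉ S, ((3 : ℕ) : 𝓞 ℚ) ∉ v.asIdeal ∧ W'.HasGoodReductionAt v)
    (hrank' : W'.mordellWeilRank = 0) (hsha' : Nat.card (AddCommGroup.primaryComponent W'.sha 3) = 1)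
    (hloc' : ∀ v ∈ S, ∀ x : W'.geomPrimaryTorsion 3, 3 • x = 0 → (∀ d ∈ decomp v, d • x = x) → x = 0) :
    MissingUpperBoundAt W 3 :=
  WildFineSelmerSupersingularCMAnchor.missingUpperBoundAt_wild_of_conjA hKatoA hGZK hmod W hr hO hirr
    (WildFineSelmerCongruenceFact.conjA_of_modPCongruent hLS (by norm_num) hcong
      (conjA_rat_of_fineUnitData W' S hS hrank' hsha' hloc'))

/-- **The same with the anchor's global data in PRINTED form**: `r_an(W′) = 0` and `3 ∤ #Ш(W′/ℚ)`.
[cite: GreenbergLNM1716, Prop. 3.8 (pp. 95–96)] [cite: LimSujatha2018, §3 Prop. 3.2] -/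
theorem missingUpperBoundAt_wild_of_fineUnitAnchor_analytic
    (hLS : LimSujatha2018.prop32_fineSelmerDual_moduleFinite_iff_of_torsionIso)
    (hKatoA :
      Kato2004.rankZero_padicValNat_sha_add_padicValNat_tamagawa_le_of_additive_potGood_of_irreducible_of_fineSelmerDual_fg)
    (hGZK : rank_eq_analyticRank_of_analyticRank_le_one) (hmod : hasEntireLFunction_rat)
    (W : WeierstrassCurve ℚ) [W.IsElliptic] [W.IsGloballyMinimal] [Fact (3 : ℕ).Prime]
    (hr : W.analyticRank = 0) (hO : ClassO6 W 3) (hirr : W.HasIrreducibleModPGaloisRep 3)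
    (W' : WeierstrassCurve ℚ) [W'.IsElliptic] (hcong : ModPCongruent W' W 3)
    (S : Finset (HeightOneSpectrum (𝓞 ℚ)))
    (hS : ∀ v ∉ S, ((3 : ℕ) : 𝓞 ℚ) ∉ v.asIdeal ∧ W'.HasGoodReductionAt v)
    (hr' : W'.analyticRank = 0) (hsha' : ¬ 3 ∣ Nat.card W'.sha)
    (hloc' : ∀ v ∈ S, ∀ x : W'.geomPrimaryTorsion 3, 3 • x = 0 → (∀ d ∈ decomp v, d • x = x) → x = 0) :
    MissingUpperBoundAt W 3 :=
  WildFineSelmerSupersingularCMAnchor.missingUpperBoundAt_wild_of_conjA hKatoA hGZK hmod W hr hO hirr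
    (WildFineSelmerCongruenceFact.conjA_of_modPCongruent hLS (by norm_num) hcong
      (conjA_rat_of_analyticRankZero_of_fineUnitData hGZK W' S hS hr' hsha' hloc'))

/-- **The same with a SMALL-CONDUCTOR anchor**: `N_{W′} < 5000`, `rank W′(ℚ) = 0` and `Ш_an(W′) = m` with
`3 ∤ m` — then `#Ш(W′) = m` by the verified BSD formula below conductor `5000` (Creutz–Miller / Cremona,
bsd.S31 `hS31`, g4's `natCard_sha_eq_of_conductor_lt_of_shaAn_eq`; `W′` globally minimal for the conductor).
[cite: CreutzMiller2012, Thm. 1.1] [cite: GreenbergLNM1716, Prop. 3.8 (pp. 95–96)] [cite: LimSujatha2018, §3 Prop. 3.2] -/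
theorem missingUpperBoundAt_wild_of_smallConductorFineUnitAnchor
    (hLS : LimSujatha2018.prop32_fineSelmerDual_moduleFinite_iff_of_torsionIso)
    (hKatoA :
      Kato2004.rankZero_padicValNat_sha_add_padicValNat_tamagawa_le_of_additive_potGood_of_irreducible_of_fineSelmerDual_fg)
    (hGZK : rank_eq_analyticRank_of_analyticRank_le_one) (hmod : hasEntireLFunction_rat)
    (hS31 : bsdTriple_of_rank_le_one_of_conductor_lt)
    (W : WeierstrassCurve ℚ) [W.IsElliptic] [W.IsGloballyMinimal] [Fact (3 : ℕ).Prime]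
    (hr : W.analyticRank = 0) (hO : ClassO6 W 3) (hirr : W.HasIrreducibleModPGaloisRep 3)
    (W' : WeierstrassCurve ℚ) [W'.IsElliptic] [W'.IsGloballyMinimal] (hcong : ModPCongruent W' W 3)
    (S : Finset (HeightOneSpectrum (𝓞 ℚ)))
    (hS : ∀ v ∉ S, ((3 : ℕ) : 𝓞 ℚ) ∉ v.asIdeal ∧ W'.HasGoodReductionAt v)
    (hN' : W'.conductorNorm ℤ < 5000) (hrank' : W'.mordellWeilRank = 0)
    {m : ℕ} (hshaAn' : shaAn W' = (m : ℂ)) (hm : ¬ 3 ∣ m)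
    (hloc' : ∀ v ∈ S, ∀ x : W'.geomPrimaryTorsion 3, 3 • x = 0 → (∀ d ∈ decomp v, d • x = x) → x = 0) :
    MissingUpperBoundAt W 3 := by
  obtain ⟨hfin, hcard⟩ :=
    WildFineSelmerSmallConductorAnchor.natCard_sha_eq_of_conductor_lt_of_shaAn_eq hS31 W'
      (by rw [hrank']; exact zero_le_one) hN' hshaAn'
  haveI : Finite W'.sha := hfin
  have h1 : Nat.card (AddCommGroup.primaryComponent W'.sha 3) = 1 := by
    rw [card_addPrimaryComponent_eq_pow 3, hcard, Nat.factorization_eq_zero_of_not_dvd hm, pow_zero]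
  exact missingUpperBoundAt_wild_of_fineUnitAnchor hLS hKatoA hGZK hmod W hr hO hirr W' hcong S hS
    hrank' h1 hloc'

/-! ## §3 The crux body from per-row fine unit-anchor certificates -/

/-- **The crux body from per-row FINE unit-anchor certificates** (class form; the `hcert` currency for the
census seats): if every ♯ row of `WildFineSelmerCoatesSujatha` (item 19386) admits ONE congruent elliptic
curve `W′/ℚ` — any reduction type at `3` — with `rank 0`, `#Ш[3^∞] = 1` and no `D_v`-fixed `3`-torsion on a
finite set `S` off which `W′` is good and `v ∤ 3`, the BODY of the route decl holds verbatim — via g3's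
`WildFineSelmerCongruenceFact.wildFineSelmerCoatesSujatha_of_mixedCertificates` (its (A)-disjunct, fed by
`conjA_rat_of_fineUnitData`). Conditional on `hLS` only; the item is NOT closed.
[cite: LimSujatha2018, §3 Prop. 3.2] [cite: GreenbergLNM1716, Prop. 3.8 (pp. 95–96)] [cite: CoatesSujatha2005, §3] -/
theorem wildFineSelmerCoatesSujatha_of_fineUnitAnchorCertificates
    (hLS : LimSujatha2018.prop32_fineSelmerDual_moduleFinite_iff_of_torsionIso)
    (hcert : ∀ (W : WeierstrassCurve ℚ) [W.IsElliptic] [W.IsGloballyMinimal] [Fact (3 : ℕ).Prime],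
      W.analyticRank = 0 → ClassO6 W 3 → W.HasIrreducibleModPGaloisRep 3 →
      ¬ (∀ n : ℕ, W.HasSurjectiveModNGaloisRep (3 ^ n : ℕ)) → ¬ W.HasCM →
      ∃ (W' : WeierstrassCurve ℚ) (_ : W'.IsElliptic) (S : Finset (HeightOneSpectrum (𝓞 ℚ))),
        ModPCongruent W' W 3 ∧ (∀ v ∉ S, ((3 : ℕ) : 𝓞 ℚ) ∉ v.asIdeal ∧ W'.HasGoodReductionAt v) ∧
        W'.mordellWeilRank = 0 ∧ Nat.card (AddCommGroup.primaryComponent W'.sha 3) = 1 ∧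
        (∀ v ∈ S, ∀ x : W'.geomPrimaryTorsion 3, 3 • x = 0 → (∀ d ∈ decomp v, d • x = x) → x = 0)) :
    ∀ (W : WeierstrassCurve ℚ) [W.IsElliptic] [W.IsGloballyMinimal] [Fact (3 : ℕ).Prime],
      W.analyticRank = 0 → ClassO6 W 3 → W.HasIrreducibleModPGaloisRep 3 →
      ¬ (∀ n : ℕ, W.HasSurjectiveModNGaloisRep (3 ^ n : ℕ)) → ¬ W.HasCM →
      ∀ (κ : ZpExtension ℚ 3), κ.IsCyclotomic →
        ∃ (γ : absoluteGaloisGroup ℚ) (D : W.FineSelmerDualData κ γ),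
          Module.Finite ℤ_[3] (RestrictScalars ℤ_[3] (IwasawaAlgebra 3) D.X) := by
  refine WildFineSelmerCongruenceFact.wildFineSelmerCoatesSujatha_of_mixedCertificates hLS
    fun W _ _ _ hr hO hirr hns hcm ↦ ?_
  obtain ⟨W', hW'e, S, hcong, hS, hrank', hsha', hloc'⟩ := hcert W hr hO hirr hns hcm
  haveI := hW'e
  exact ⟨W', hW'e, hcong, Or.inl (conjA_rat_of_fineUnitData W' S hS hrank' hsha' hloc')⟩

end Summit.BirchSwinnertonDyer.BirchSwinnertonDyer.Theorems.WildFineSelmerFineUnitAnchor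

end
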